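import Literature.MathematicalPhysics.QuantumFieldTheory.Balaban1983to89.B8Prop7TowerAxialIneq145P
import Literature.MathematicalPhysics.QuantumFieldTheory.Balaban1983to89.B8TowerBondsNonempty

/-!
# `Balaban1983to89.B8Prop7TowerAxialAdmissible` — [Balaban1985RegularSpaces] Prop. 7's COLLAR HYPOTHESIS IS PRINT'S (1.3)–(1.4) AS TYPED:
# the displayed collar law of the two P-carrier (1.145) editions (`B8Prop7TowerAxialCollarP`, n05-w1 g0; `B8Prop7TowerAxialIneq145P`, this seat) FOLLOWS
# from the tree's admissibility record `B8ConstraintBonds.DomainSeq L Ω` at `Ω₀ = ℤᵈ`; Proposition 7 (repaired) for print's tower-wise map on the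
# ADMISSIBLE sub-family of NODE 00's sub-index of record, and its A6 witness (print's tower `(T, □₁, …, □_k)`, admissible by `cubeFam_domainSeq`)

statement-level skeleton of published theorems with citation tags; proofs where landed; nothing here is a claim about the Yang–Mills mass gap

T. Bałaban, *Spaces of regular gauge field configurations on a lattice and gauge fixing conditions*, Commun. Math. Phys. **99** (1985) 75–102
`[Balaban1985RegularSpaces]` ("B8"; journal page = PDF page + 74): (1.3)–(1.4) p. 77 («Ω₀ ⊃ Ω₁ ⊃ … ⊃ Ω_k», «Ω_j = Bʲ(Ω_j^{(j)}), Ω_j is a sum of cubes …,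
(Lʲη)⁻¹dist(Ω_jᶜ, Ω_{j+1}) > RM₁», «R is a sufficiently large positive integer (a power of L)»), p. 77 (bond convention), Prop. 7 (1.144)–(1.145) p. 100,
(1.131) p. 99, p. 98.  [3] = `[Balaban1985Averaging]`, p. 24 (the box `B(c₋) ∪ B(c₊)` of a bond).

## WHY THIS FILE (cell `pub-ymgap`, HUMAN RULING D-0062 ∕ D-0149; DAG node N05 = [B8]; width seat `pub-ymgap-dag-n05-w2` g2; proof lane, count-neutral)

Both landed editions of [B8] Prop. 7's (1.145) in the P-carrier's ONE-END-POINT letter — n05-w1 g0's direct `B8Prop7TowerAxialCollarP.prop7RepairedC_zdGF3(H)P_toAxialTower`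
(p598716, constant `530d·L²`) and this seat's one-level-up `B8Prop7TowerAxialIneq145P.prop7RepairedC_zdGF3(H)P_toAxialTower_oneUp` (p598518) — display the
SAME member hypothesis `hcollar : ∀ j ≤ k, ∀ z μ, EndBlockIn L (Ω j) j z μ → ∀ x, InBox (loK L j z) (bondHiK L j z μ) x → x ∈ Ω (j − 1)` («the two-block box of a
level-`j` bond with an end-block in `Ω_j` lies in `Ω_{j−1}`»), because NODE 00's typed index `B8LeafModelZd.ZdIdx` ∕ `IdxB8SubB` carries no collar.  The tree
DOES type print's (1.3)–(1.4), for the `ℤᵈ` carriers, as `B8ConstraintBonds.DomainSeq L Ω` (`anti` = (1.3); `sat` = «Ω_j = Bʲ(Ω_j^{(j)})»; `sep` = the `ℓ∞`-ball of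
radius `L^{j+1}` about a point of `Ω_{j+1}` lies in `Ω_j`, i.e. «(Lʲη)⁻¹dist(Ω_jᶜ, Ω_{j+1}) > RM₁» with `RM₁ ≥ L`), and certifies print's Sect. F tower admissible
(`B8Eq131CubesAdmissible.cubeFam_domainSeq`, `ρ = R₁M₁ ≥ L`).  THIS FILE closes the gap between the two vocabularies: at `Ω₀ = ℤᵈ` the collar hypothesis IS a
consequence of `DomainSeq` (§1), so both editions hold on the ADMISSIBLE members with no further display (§2), and the admissible sub-family of `IdxB8SubB θ` is
inhabited by print's nested tower (§3).  (The hypothesis quantified over ALL of `IdxB8SubB θ` would be another matter: the typed laws admit members with equal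
consecutive non-univ domains — cell bus 2026-08-28 02:52Z LOCATED-COLLAR-FORALL; faces are keyed on sub-families.)

## WHAT IS PROVED (kernel, 0 sorry; theorems only, lattice bookkeeping + by-name instances)

* §1 ★★ `collar_of_domainSeq` — `L ≥ 1`, `Ω 0 = univ`, `DomainSeq L Ω` ⇒ the collar hypothesis at EVERY level `j` (at `j = n + 1`: a box site under the
  end-block inside `Ω_{n+1}` lies in `Ω_{n+1} ⊆ Ω_n`; one under the other end-block is the `±L^{n+1}e_μ`-translate of such a site, so `sep` puts it in `Ω_n`;
  `j = 0`: `Ω_0 = ℤᵈ`); `collar_of_domainSeq'` (the `∀ j ≤ k` binder shape of the two editions).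
* §2 ★★ `prop7RepairedC_zdGF3P_toAxialTower_oneUp_of_domainSeq` ∕ `…zdGF3HP…` — this seat's edition over any index map into ADMISSIBLE `Ω₀ = ℤᵈ` law members
  (`DomainSeq` replacing `hcollar`); ★ `prop7RepairedC_famB8OfRecordSubBP_oneUp_admissible` — the record face at NODE 00's P-pin over the admissible sub-family
  `{j : IdxB8SubB θ ∕∕ DomainSeq θ.L j.1.1.Ω}` (pin `toAxialTowerResid`, `θ.D ≥ 2`).  (The sharp-constant twins on n05-w1's p598716 are ONE `exact` each with
  `collar_of_domainSeq'` — left to that seat's announced record file, INTENT-11.)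
* §3 A6 `exists_idxB8SubB_domainSeq_topCube` — for every `θ` and `k ≥ 1` the lawful top-cube member of `IdxB8SubB θ` (`Ω = cubeFam true θ.L 0 1 θ.L k`, `ρ = L`;
  n05-c's `exists_topCube_member_lawsB`) is ADMISSIBLE (`cubeFam_domainSeq`): the sub-family of §2 is inhabited by a genuinely nested tower.

## HONEST SCOPE

Lattice bookkeeping (§1) and by-name instances (§2–§3); NO estimate of [Balaban1985RegularSpaces] ∕ [3] is proved anew or asserted; constants and thresholds are
the editions' (`26384(d+1)L·530d`, `min (c(d,L)) (…)`), not print's `2` ∕ «sufficiently small»; `DomainSeq` is print's (1.3)–(1.4) as typed in the tree (with the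
located reading `RM₁ ≥ L` of «R a power of L», «M₁ big»), now the ONLY hypothesis beyond the typed index laws; the typed `Prop7PrintedR` slot of the knits is NOT
re-typed here.  Count-neutral; N05 NOT discharged; no count claim (the chair's single count line is the only count); `T_η ↦ ℤᵈ`; one finite `𝕋⁴` programme at
fixed `ε`, Bałaban AS PRINTED; the Yang–Mills mass gap (Clay) is NOT proved by any of this — R4 closes the conditional finite-`𝕋⁴` rung `BalabanLadder.UV` only;
nothing continuum ∕ ℝ⁴ ∕ OS.  No `sorry`, no `def`, no `instance`, no `notation`.  Unit `pub-ymgap-dag-n05-w2` (g2), 2026-08-28.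

RELATED IN THE TREE, NOT DUPLICATED: `B8ConstraintBonds` (`DomainSeq`, USED), `B8Eq131CubesAdmissible` (`cubeFam_domainSeq`, USED), `B8TowerBondsNonempty`
(`under_or_of_bondBox`, USED), `B8Prop7TowerAxialIneq145P` (this seat, USED), `B8Prop7TowerAxialCollarP` (n05-w1 g0; its twins are one `exact` away, not typed here),
`B8TowerBondsLevelSep` (this seat: the unit-collar (L1) from `DomainSeq`, same road).

[cite: Balaban1985RegularSpaces, (1.3)–(1.4) p.77, p.77, Prop. 7 (1.144)–(1.145) p.100, (1.131) p.99, p.98; Balaban1985Averaging, p.24]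
-/

noncomputable section

open NormedSpace

namespace Literature.MathematicalPhysics.QuantumFieldTheory.Balaban1983to89.B8Prop7TowerAxialAdmissible

open B7Prop1Explicit B7Prop1Local
open B8Ineq130 (tlo thi tlo_apply thi_apply)
open B8Ineq132 (Under)
open B8Eq106Local (under_iff_tower)
open B8ConstraintBonds (DomainSeq)
open B8Eq131CubesAdmissible (cubeFam cubeFam_true_zero cubeFam_domainSeq)
open B8IdxB8LawsB (under_or_of_bondBox IdxB8SubB)
open B8SockB9P3ShellModeVacuityUniv (exists_topCube_member_lawsB)
open B8Prop7TowerAxialZd3 (toAxialTower)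
open B8Prop7TowerAxialRecord (toAxialTowerResid)
open B8Prop7TowerAxialIneq145P (prop7RepairedC_zdGF3P_toAxialTower_oneUp prop7RepairedC_zdGF3HP_toAxialTower_oneUp)
open B8LeafModelZd (ZdIdx)
open B8LeafModelZd3P (zdGF3P zdGF3HP EndBlockIn)
open Node00 (famB8OfRecordSubBP)

-- `Site` alone could resolve to the torus sites of `Setup.lean`; re-export the `ℤ^d` sites of `B7Prop1Explicit`.
export B7Prop1Explicit (Site)

variable {d : ℕ}

/-! ## §1 The collar hypothesis from print's (1.3)–(1.4) as typed (`B8ConstraintBonds.DomainSeq`) -/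

section Collar

variable {L : ℕ}

/-- A site under `z + e_μ` at depth `m`, translated back by `Lᵐe_μ`, lies under `z` (private plumbing). [folklore] -/
private theorem under_sub_of_under_add_e {m : ℕ} {z x : Site d} {μ : Fin d} (hx : Under L m (z + e μ) x) :
    Under L m z (x - ((L : ℤ) ^ m) • e μ) := by
  intro i
  obtain ⟨h1, h2⟩ := hx i
  simp only [Pi.add_apply, e_apply] at h1 h2
  simp only [Pi.sub_apply, Pi.smul_apply, smul_eq_mul, e_apply]
  split_ifs at h1 h2 ⊢ <;> constructor <;> nlinarith

/-- A site under `z` at depth `m`, translated by `Lᵐe_μ`, lies under `z + e_μ` (private plumbing). [folklore] -/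
private theorem under_add_of_under {m : ℕ} {z x : Site d} {μ : Fin d} (hx : Under L m z x) :
    Under L m (z + e μ) (x + ((L : ℤ) ^ m) • e μ) := by
  intro i
  obtain ⟨h1, h2⟩ := hx i
  simp only [Pi.add_apply, Pi.smul_apply, smul_eq_mul, e_apply]
  split_ifs <;> constructor <;> nlinarith

/-- A site under `w` at depth `m` lies in the block `[tlo L w m, thi L w m]` (private plumbing: `B8Eq106Local.under_iff_tower`). [folklore] -/
private theorem inBox_tower_of_under {m : ℕ} {w x : Site d} (hx : Under L m w x) : InBox (tlo L w m) (thi L w m) x := by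
  obtain ⟨h1, h2⟩ := (under_iff_tower L m w x).1 hx
  exact fun i => ⟨h1 i, h2 i⟩

/-- ★★ **THE COLLAR HYPOTHESIS IS PRINT'S (1.3)–(1.4)**: for `L ≥ 1`, a region sequence `Ω` with `Ω_0 = ℤᵈ` that is ADMISSIBLE in the tree's typed sense
`B8ConstraintBonds.DomainSeq L Ω` (nesting; `Ω_j` a union of `j`-blocks; the `ℓ∞`-ball of radius `L^{j+1}` about a point of `Ω_{j+1}` inside `Ω_j`) satisfies
the displayed member hypothesis of both P-carrier (1.145) editions at EVERY level `j`: the two-block box `Bʲ(z) ∪ Bʲ(z + e_μ)` of a level-`j` bond with an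
end-block in `Ω_j` lies in `Ω_{j−1}`.  PROOF: a box site lies under one of the two ends ([3] p. 24; `under_or_of_bondBox`); under the end inside `Ω_j` it is in
`Ω_j ⊆ Ω_{j−1}`; under the other end it is the `±Lʲe_μ`-translate of a site of the good block, hence in `Ω_{j−1}` by `sep` (`j ≥ 1`); at `j = 0`, `Ω_0 = ℤᵈ`.
[cite: Balaban1985RegularSpaces, (1.3)–(1.4) p.77, p.77; Balaban1985Averaging, p.24] -/
theorem collar_of_domainSeq (hL : 1 ≤ L) {Ω : ℕ → Set (Site d)} (hΩ0 : Ω 0 = Set.univ) (h : DomainSeq L Ω) :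
    ∀ j, ∀ (z : Site d) (μ : Fin d), EndBlockIn L (Ω j) j z μ →
      ∀ x, InBox (loK L j z) (bondHiK L j z μ) x → x ∈ Ω (j - 1) := by
  intro j z μ hend x hx
  rcases Nat.eq_zero_or_pos j with rfl | hj
  · rw [Nat.zero_sub, hΩ0]; exact Set.mem_univ x
  obtain ⟨n, rfl⟩ : ∃ n, j = n + 1 := ⟨j - 1, by omega⟩
  rw [Nat.add_sub_cancel]
  have hbound : ∀ i, |(((L : ℤ) ^ (n + 1)) • e μ) i| ≤ (L : ℤ) ^ (n + 1) := fun i => by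
    have hP : (0 : ℤ) ≤ (L : ℤ) ^ (n + 1) := by positivity
    simp only [Pi.smul_apply, smul_eq_mul, e_apply]
    split_ifs <;> simp [abs_of_nonneg hP]
  have hboundn : ∀ i, |(-(((L : ℤ) ^ (n + 1)) • e μ)) i| ≤ (L : ℤ) ^ (n + 1) := fun i => by
    rw [Pi.neg_apply, abs_neg]; exact hbound i
  rcases under_or_of_bondBox (n + 1) z μ hx with hu | hu
  · -- `x ∈ Bʲ(z)`
    rcases hend with hz | hz
    · exact h.anti n (hz x (inBox_tower_of_under hu))
    · -- `Bʲ(z + e_μ) ⊂ Ω_j`: translate `x` forward into it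
      have hx' : x + ((L : ℤ) ^ (n + 1)) • e μ ∈ Ω (n + 1) := hz _ (inBox_tower_of_under (under_add_of_under hu))
      have hs := h.sep n _ (-(((L : ℤ) ^ (n + 1)) • e μ)) hx' hboundn
      rwa [add_neg_cancel_right] at hs
  · -- `x ∈ Bʲ(z + e_μ)`
    rcases hend with hz | hz
    · -- `Bʲ(z) ⊂ Ω_j`: translate `x` back into it
      have hx' : x - ((L : ℤ) ^ (n + 1)) • e μ ∈ Ω (n + 1) := hz _ (inBox_tower_of_under (under_sub_of_under_add_e hu))
      have hs := h.sep n _ (((L : ℤ) ^ (n + 1)) • e μ) hx' hbound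
      rwa [sub_add_cancel] at hs
    · exact h.anti n (hz x (inBox_tower_of_under hu))

/-- The collar hypothesis in the `∀ j ≤ k` binder shape of the two editions (`hcollar` ∕ `hcol`), from `DomainSeq`. [cite: Balaban1985RegularSpaces, (1.3)–(1.4) p.77] -/
theorem collar_of_domainSeq' (hL : 1 ≤ L) (i : ZdIdx d L) (hΩ0 : i.Ω 0 = Set.univ) (h : DomainSeq L i.Ω) :
    ∀ j, j ≤ i.k → ∀ (z : Site d) (μ : Fin d), EndBlockIn L (i.Ω j) j z μ →
      ∀ x, InBox (loK L j z) (bondHiK L j z μ) x → x ∈ i.Ω (j - 1) :=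
  fun j _ z μ hend x hx => collar_of_domainSeq hL hΩ0 h j z μ hend x hx

end Collar

/-! ## §2 Proposition 7 (repaired) for print's map on the P-carrier AT ADMISSIBLE MEMBERS, and the record face on the admissible sub-family -/

section Admissible

variable (𝔸 : Type) [CStarAlgebra 𝔸] [Nontrivial 𝔸] (L : ℕ) (β : ℝ) (len : Site d → ℝ)

/-- ★★ **PROPOSITION 7 (repaired, one-level-up constant) FOR PRINT'S TOWER-WISE MAP ON THE P-CARRIER AT EVERY ADMISSIBLE `Ω₀ = ℤᵈ` LAW MEMBER**: this seat's
`prop7RepairedC_zdGF3P_toAxialTower_oneUp` with the collar hypothesis DISCHARGED by `DomainSeq` (print's (1.3)–(1.4) as typed) — over any index map `e` into members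
with `Ω₀ = ℤᵈ`, law №8 and `DomainSeq L (e a).Ω`. [cite: Balaban1985RegularSpaces, Prop. 7 (1.144)–(1.145) p.100, (1.3)–(1.4) p.77] -/
theorem prop7RepairedC_zdGF3P_toAxialTower_oneUp_of_domainSeq (hd2 : 2 ≤ d) (hL : 2 ≤ L) {J : Type} (e : J → ZdIdx d L)
    (hΩ0 : ∀ a, (e a).Ω 0 = Set.univ)
    (hlt : ∀ a, ∀ m, m < (e a).k → ∀ j, j < m → (e a).Λs m j = (e a).Λs (m + 1) j)
    (htop : ∀ a, ∀ m, m < (e a).k → ∀ x, x ∈ (e a).Λs m m ↔ x ∈ (e a).Λs (m + 1) m ∨ ∃ y ∈ (e a).Λs (m + 1) (m + 1),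
      x ∈ Literature.MathematicalPhysics.QuantumLattice.blockSites L y)
    (hadm : ∀ a, DomainSeq L (e a).Ω) :
    B8Ineq145.Prop7RepairedC (26384 * ((d : ℝ) + 1) * L * (530 * (d : ℝ))) (fun a : J => zdGF3P 𝔸 L β len (e a))
      (fun a => toAxialTower 𝔸 L β len (le_trans one_le_two hL) (e a)) :=
  prop7RepairedC_zdGF3P_toAxialTower_oneUp 𝔸 L β len hd2 hL e hΩ0 hlt htop
    (fun a => collar_of_domainSeq' (le_trans one_le_two hL) (e a) (hΩ0 a) (hadm a))

/-- The `zdGF3HP` twin (Theorem 8's source space as printed; Prop. 7 reads no source). [cite: Balaban1985RegularSpaces, Prop. 7 (1.144)–(1.145) p.100, (1.3)–(1.4) p.77] -/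
theorem prop7RepairedC_zdGF3HP_toAxialTower_oneUp_of_domainSeq (hd2 : 2 ≤ d) (hL : 2 ≤ L) {J : Type} (e : J → ZdIdx d L)
    (hΩ0 : ∀ a, (e a).Ω 0 = Set.univ)
    (hlt : ∀ a, ∀ m, m < (e a).k → ∀ j, j < m → (e a).Λs m j = (e a).Λs (m + 1) j)
    (htop : ∀ a, ∀ m, m < (e a).k → ∀ x, x ∈ (e a).Λs m m ↔ x ∈ (e a).Λs (m + 1) m ∨ ∃ y ∈ (e a).Λs (m + 1) (m + 1),
      x ∈ Literature.MathematicalPhysics.QuantumLattice.blockSites L y)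
    (hadm : ∀ a, DomainSeq L (e a).Ω) :
    B8Ineq145.Prop7RepairedC (26384 * ((d : ℝ) + 1) * L * (530 * (d : ℝ))) (fun a : J => zdGF3HP 𝔸 L β len (e a))
      (fun a => toAxialTower 𝔸 L β len (le_trans one_le_two hL) (e a)) :=
  prop7RepairedC_zdGF3P_toAxialTower_oneUp_of_domainSeq 𝔸 L β len hd2 hL e hΩ0 hlt htop hadm

variable {𝔸 L β len}

open Node00 in
/-- ★ **THE RECORD FACE ON THE ADMISSIBLE SUB-FAMILY**: Proposition 7 (repaired constant `26384(θ.D+1)θ.L·530θ.D`, print's one-end-point (1.145)) for print's map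
pinned as `toAxialTowerResid`, at NODE 00's P-carrier of record `famB8OfRecordSubBP θ β len`, over the members `j : IdxB8SubB θ` whose Ω-tower is ADMISSIBLE in
print's sense (1.3)–(1.4) as typed (`DomainSeq θ.L j.Ω`) — no collar display left; `θ.D ≥ 2`.  Inhabited: §3.
[cite: Balaban1985RegularSpaces, Prop. 7 (1.144)–(1.145) p.100, (1.3)–(1.4) p.77] -/
theorem prop7RepairedC_famB8OfRecordSubBP_oneUp_admissible {θ : Stage3Params} (β : ℝ) (len : Site θ.D → ℝ) (hD : 2 ≤ θ.D) :
    B8Ineq145.Prop7RepairedC (26384 * ((θ.D : ℝ) + 1) * θ.L * (530 * (θ.D : ℝ)))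
      (fun j : {j : IdxB8SubB θ // DomainSeq θ.L j.1.1.Ω} => famB8OfRecordSubBP θ β len j.1)
      (fun j => toAxialTowerResid θ β len j.1.1) :=
  prop7RepairedC_zdGF3HP_toAxialTower_oneUp_of_domainSeq θ.𝔸 θ.L β len hD θ.two_le_L
    (fun j : {j : IdxB8SubB θ // DomainSeq θ.L j.1.1.Ω} => j.1.1.1)
    (fun j => j.1.1.2) (fun j => j.1.2.toIdxB8Laws.trunc_lt) (fun j => j.1.2.toIdxB8Laws.trunc_top) (fun j => j.2)

end Admissible

/-! ## §3 A6: the admissible sub-family of the sub-index of record contains print's nested tower -/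

section Witness

/-- **A6 — THE ADMISSIBLE SUB-FAMILY OF `IdxB8SubB θ` CONTAINS PRINT'S NESTED TOWER `(T, □₁, …, □_k)` AT EVERY DEPTH `k ≥ 1`** (`η = L⁻ᵏ`, `a = 0`, `M = 1`,
`ρ = L`): n05-c's lawful top-cube member (`exists_topCube_member_lawsB`) has `Ω = cubeFam true θ.L 0 1 θ.L k`, which is `DomainSeq`-admissible by
`B8Eq131CubesAdmissible.cubeFam_domainSeq` (`ρ = L ≥ L`).  So §2's record face is a statement about a non-empty, genuinely nested family.
[cite: Balaban1985RegularSpaces, (1.131) p.99, (1.3)–(1.4) p.77, p.98–99 («The sequence of cubes {□_j} is an admissible family»)] -/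
theorem exists_idxB8SubB_domainSeq_topCube (θ : Node00.Stage3Params) {k : ℕ} (hk : 1 ≤ k) :
    ∃ j : IdxB8SubB θ, j.1.1.k = k ∧ j.1.1.Ω = cubeFam true θ.L 0 1 θ.L k ∧ DomainSeq θ.L j.1.1.Ω := by
  have hL : 1 ≤ θ.L := le_trans (by norm_num) θ.two_le_L
  have hL0 : (0 : ℝ) < θ.L := by exact_mod_cast (show 0 < θ.L by omega)
  have hη : (0 : ℝ) < ((θ.L : ℝ)⁻¹) ^ k := pow_pos (inv_pos.mpr hL0) k
  have hscale : (θ.L : ℝ) ^ k * ((θ.L : ℝ)⁻¹) ^ k ≤ 1 := by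
    rw [← mul_pow, mul_inv_cancel₀ hL0.ne', one_pow]
  obtain ⟨i, hik, -, hΩ, -, -, -, hlaws⟩ :=
    exists_topCube_member_lawsB (d := θ.D) hL (0 : Site θ.D) 1 (le_refl θ.L) hk hη hscale
  have hΩ0 : i.Ω 0 = Set.univ := by rw [hΩ]; exact cubeFam_true_zero θ.L 0 1 θ.L k
  refine ⟨⟨⟨i, hΩ0⟩, hlaws⟩, hik, hΩ, ?_⟩
  show DomainSeq θ.L i.Ω
  rw [hΩ]
  exact cubeFam_domainSeq true hL 0 1 (le_refl θ.L) k

end Witness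

end Literature.MathematicalPhysics.QuantumFieldTheory.Balaban1983to89.B8Prop7TowerAxialAdmissible

end
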